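import Literature.Analysis.FunctionSpaces.LittlewoodPaleyKernel
import Mathlib.Analysis.Fourier.Convolution
import HarnessLib

/-!
# Fourier supports of products of Littlewood–Paley blocks (Bony's bookkeeping)

Analysis/FunctionSpaces support file (serves the discharge of
`Literature.Analysis.FluidPDE.cheskidov_shvydkoy`, ns.S31: Cheskidov–Shvydkoy decompose the
localised nonlinearity `(u ⊗ u)_q` in paraproducts and a remainder, arXiv:0708.3067 p. 5,
"`(u ⊗ u)_q = r_q(u,u) + u_q ⊗ u + u ⊗ u_q`", and every estimate of this kind rests on the fact
that the block `Δ̇_j` of a product of two blocks `Δ̇_i a · Δ̇_{i'} b` vanishes unless the indices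
are compatible: `supp 𝓕(Δ̇_i a · Δ̇_{i'} b) ⊆ supp φ_i + supp φ_{i'}`).

All results are **proved**:

* Schwartz level (`blockS j a = h_j ⋆ a` as a Schwartz function, `mulS a b = a · b`):
  `𝓕(Δ̇_j a) = φ_j 𝓕a` (`fourier_blockS_apply`), `𝓕(ab)(ξ) = ∫ 𝓕b(η) 𝓕a(ξ - η) dη`
  (`fourier_mulS_apply`, Mathlib's convolution theorem read backwards), support of the Fourier
  transform of a product above/below (`fourier_mulS_apply_eq_zero_of_lt_norm`,
  `fourier_mulS_apply_eq_zero_of_norm_add_lt`), and the vanishing rules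
  `Δ̇_j (Δ̇_i a · Δ̇_{i'} b) = 0` for `j ≥ max i i' + 3` (`blockS_mulS_blockS_eq_zero_of_le`) and for
  `j, i' ≤ i - 3` (`blockS_mulS_blockS_eq_zero_of_le_sub`, and its symmetric twin);
* `L²` level by density of Schwartz functions (`SchwartzMap.denseRange_toLpCLM`) and the
  continuity `L² × L² → L^∞` of `(u, w) ↦ Δ̇_j (Δ̇_i u · Δ̇_{i'} w)` (Young + Hölder):
  `blockFn_mul_eq_zero` (complex scalars), `blockFn_mul_eq_zero_real` (real scalars),
  `blockFn_smul_eq_zero_real` (real scalar times an `ℝ^ι`-valued field — the shape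
  `Δ̇_j (u_i^k u_{i'})` of the terms of `Δ̇_j (u ⊗ u)`), all under
  `ParaproductVanishing i i' j : max i i' + 3 ≤ j ∨ (j ≤ i - 3 ∧ i' ≤ i - 3) ∨ (j ≤ i' - 3 ∧ i ≤ i' - 3)`.

The thresholds `3` are those of the dyadic convention of `LittlewoodPaley.lean`
(`supp φ_j ⊆ {2^{j-1} ≤ ‖ξ‖ ≤ 2^{j+1}}`): `2^{i+1} + 2^{i'+1} ≤ 2^{max+2} = 2^{(max+3)-1}` and
`2^{j+1} + 2^{i'+1} ≤ 2^{i-2} + 2^{i-2} = 2^{i-1}`.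

## References

* H. Bahouri, J.-Y. Chemin, R. Danchin, *Fourier Analysis and Nonlinear PDE*, Springer 2011,
  §2.6.1 (Bony's decomposition, the supports of `𝓕(Ṡ_{j-1}u Δ̇_j v)` and `𝓕(Δ̇_j u Δ̇_{j'} v)`),
  §1.2 (Fourier transform of products and convolutions). [BCD]
* A. Cheskidov, R. Shvydkoy, Arch. Ration. Mech. Anal. 195 (2010), p. 5. [CheskidovShvydkoy2010]
-/

noncomputable section

open MeasureTheory FourierTransform SchwartzMap Real Complex Filter Topology Function
open scoped FourierTransform RealInnerProductSpace ComplexConjugate ENNReal Convolution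

/-! ## Fourier supports of blocks and of their products (Schwartz level) -/

namespace Literature.Analysis.FunctionSpaces

section SchwartzBlocks

variable {E : Type*} [NormedAddCommGroup E] [InnerProductSpace ℝ E] [FiniteDimensional ℝ E]
  [MeasurableSpace E] [BorelSpace E]

/-- The **block of a Schwartz function as a Schwartz function**: `Δ̇_j a = h_j ⋆ a`
(Mathlib's `SchwartzMap.convolution` with the multiplication pairing). [folklore] -/
def blockS (j : ℤ) (a : 𝓢(E, ℂ)) : 𝓢(E, ℂ) :=
  SchwartzMap.convolution (ContinuousLinearMap.mul ℂ ℂ) (blockKernelC E j) a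

/-- The Schwartz block is the function block `blockFn j a`. [folklore] -/
theorem coe_blockS (j : ℤ) (a : 𝓢(E, ℂ)) : ((blockS j a : 𝓢(E, ℂ)) : E → ℂ) = blockFn j (a : E → ℂ) := by
  funext x
  rw [blockS, SchwartzMap.convolution_apply, convolution_mul, blockFn_apply]
  refine integral_congr_ae (Eventually.of_forall fun t => ?_)
  simp only
  rw [← ofReal_blockKernel, Complex.real_smul]

/-- **The Fourier transform of a block**: `𝓕(Δ̇_j a) = φ_j · 𝓕 a`. [folklore] -/
theorem fourier_blockS_apply (j : ℤ) (a : 𝓢(E, ℂ)) (ξ : E) :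
    (𝓕 (blockS j a)) ξ = dyadicSymbol j ξ * (𝓕 a) ξ := by
  rw [blockS, SchwartzMap.fourier_convolution, SchwartzMap.pairing_apply_apply,
    ContinuousLinearMap.mul_apply', blockKernelC, FourierTransform.fourier_fourierInv_eq,
    coe_dyadicSymbolSchwartz]

/-- The Fourier transform of a block vanishes below the annulus: `𝓕(Δ̇_j a)(ξ) = 0` for
`‖ξ‖ ≤ 2^{j-1}`. [folklore] -/
theorem fourier_blockS_apply_eq_zero_of_norm_le {j : ℤ} (a : 𝓢(E, ℂ)) {ξ : E}
    (h : ‖ξ‖ ≤ (2 : ℝ) ^ (j - 1)) : (𝓕 (blockS j a)) ξ = 0 := by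
  rw [fourier_blockS_apply, dyadicSymbol_apply_of_norm_le_holds h, zero_mul]

/-- The Fourier transform of a block vanishes above the annulus: `𝓕(Δ̇_j a)(ξ) = 0` for
`2^{j+1} ≤ ‖ξ‖`. [folklore] -/
theorem fourier_blockS_apply_eq_zero_of_le_norm {j : ℤ} (a : 𝓢(E, ℂ)) {ξ : E}
    (h : (2 : ℝ) ^ (j + 1) ≤ ‖ξ‖) : (𝓕 (blockS j a)) ξ = 0 := by
  rw [fourier_blockS_apply, dyadicSymbol_apply_of_le_norm_holds h, zero_mul]

/-- The **pointwise product of two Schwartz functions** as a Schwartz function. [folklore] -/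
def mulS (a b : 𝓢(E, ℂ)) : 𝓢(E, ℂ) := SchwartzMap.smulLeftCLM ℂ (a : E → ℂ) b

omit [FiniteDimensional ℝ E] [MeasurableSpace E] [BorelSpace E] in
/-- `mulS a b = a · b` pointwise. [folklore] -/
@[simp]
theorem mulS_apply (a b : 𝓢(E, ℂ)) (x : E) : mulS a b x = a x * b x := by
  rw [mulS, SchwartzMap.smulLeftCLM_apply_apply a.hasTemperateGrowth, smul_eq_mul]

/-- **The Fourier transform of a product is the convolution of the Fourier transforms**:
`𝓕(a b)(ξ) = ∫ 𝓕b(η) 𝓕a(ξ - η) dη` (Mathlib's convolution theorem read backwards,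
`Literature.Analysis.FunctionSpaces.fourier_smulLeftCLM_fourierInv_apply_eq_integral`). [folklore] -/
theorem fourier_mulS_apply (a b : 𝓢(E, ℂ)) (ξ : E) :
    (𝓕 (mulS a b)) ξ = ∫ η, (𝓕 b) η * (𝓕 a) (ξ - η) := by
  have h := fourier_smulLeftCLM_fourierInv_apply_eq_integral a (𝓕 b) ξ
  rwa [FourierTransform.fourierInv_fourier_eq] at h

/-- **Support of the Fourier transform of a product, above**: if `𝓕a` vanishes outside the ball
of radius `R_a` and `𝓕b` outside the ball of radius `R_b`, then `𝓕(ab)(ξ) = 0` for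
`R_a + R_b < ‖ξ‖`. [folklore] -/
theorem fourier_mulS_apply_eq_zero_of_lt_norm {a b : 𝓢(E, ℂ)} {Ra Rb : ℝ}
    (ha : ∀ η, Ra < ‖η‖ → (𝓕 a) η = 0) (hb : ∀ η, Rb < ‖η‖ → (𝓕 b) η = 0) {ξ : E}
    (hξ : Ra + Rb < ‖ξ‖) : (𝓕 (mulS a b)) ξ = 0 := by
  rw [fourier_mulS_apply]
  refine integral_eq_zero_of_ae (Eventually.of_forall fun η => ?_)
  simp only [Pi.zero_apply]
  by_cases hη : Rb < ‖η‖
  · rw [hb η hη, zero_mul]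
  · have : Ra < ‖ξ - η‖ := by
      have h1 : ‖ξ‖ ≤ ‖ξ - η‖ + ‖η‖ := norm_le_norm_sub_add ξ η
      linarith [not_lt.1 hη]
    rw [ha _ this, mul_zero]

/-- **Support of the Fourier transform of a product, below**: if `𝓕a` vanishes inside the ball of
radius `r_a` and `𝓕b` vanishes outside the ball of radius `R_b`, then `𝓕(ab)(ξ) = 0` for
`‖ξ‖ + R_b < r_a` (the low frequencies of `b` cannot bring the annulus of `a` down to `ξ`). [folklore] -/
theorem fourier_mulS_apply_eq_zero_of_norm_add_lt {a b : 𝓢(E, ℂ)} {ra Rb : ℝ}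
    (ha : ∀ η, ‖η‖ < ra → (𝓕 a) η = 0) (hb : ∀ η, Rb < ‖η‖ → (𝓕 b) η = 0) {ξ : E}
    (hξ : ‖ξ‖ + Rb < ra) : (𝓕 (mulS a b)) ξ = 0 := by
  rw [fourier_mulS_apply]
  refine integral_eq_zero_of_ae (Eventually.of_forall fun η => ?_)
  simp only [Pi.zero_apply]
  by_cases hη : Rb < ‖η‖
  · rw [hb η hη, zero_mul]
  · have : ‖ξ - η‖ < ra := by
      have h1 : ‖ξ - η‖ ≤ ‖ξ‖ + ‖η‖ := norm_sub_le ξ η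
      linarith [not_lt.1 hη]
    rw [ha _ this, mul_zero]

/-- A Schwartz function whose Fourier transform is killed by `φ_j` has vanishing block:
if `φ_j · 𝓕h = 0` then `Δ̇_j h = 0`. [folklore] -/
theorem blockS_eq_zero_of_fourier {j : ℤ} {h : 𝓢(E, ℂ)}
    (H : ∀ ξ, dyadicSymbol j ξ * (𝓕 h) ξ = 0) : blockS j h = 0 := by
  have h1 : 𝓕 (blockS j h) = 0 := by
    ext ξ
    rw [fourier_blockS_apply, H]
    rfl
  calc blockS j h = 𝓕⁻ (𝓕 (blockS j h)) := (FourierTransform.fourierInv_fourier_eq _).symm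
    _ = 0 := by rw [h1, FourierTransform.fourierInv_zero]

/-- **Paraproduct vanishing, high output**: `Δ̇_j (Δ̇_i a · Δ̇_{i'} b) = 0` for
`j ≥ max i i' + 3`: the product has frequencies `≤ 2^{i+1} + 2^{i'+1} ≤ 2^{max + 2} ≤ 2^{j-1}`,
where `φ_j` vanishes (BCD §2.6, the bookkeeping behind Bony's decomposition). [folklore] -/
theorem blockS_mulS_blockS_eq_zero_of_le {i i' j : ℤ} (a b : 𝓢(E, ℂ)) (hj : max i i' + 3 ≤ j) :
    blockS j (mulS (blockS i a) (blockS i' b)) = 0 := by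
  refine blockS_eq_zero_of_fourier fun ξ => ?_
  by_cases hξ : ‖ξ‖ ≤ (2 : ℝ) ^ (j - 1)
  · rw [dyadicSymbol_apply_of_norm_le_holds hξ, zero_mul]
  · rw [fourier_mulS_apply_eq_zero_of_lt_norm (Ra := (2 : ℝ) ^ (i + 1)) (Rb := (2 : ℝ) ^ (i' + 1))
        (fun η hη => fourier_blockS_apply_eq_zero_of_le_norm a hη.le)
        (fun η hη => fourier_blockS_apply_eq_zero_of_le_norm b hη.le) ?_, mul_zero]
    have h2 : (0 : ℝ) < 2 := two_pos
    have hi : (2 : ℝ) ^ (i + 1) ≤ (2 : ℝ) ^ (j - 2) := zpow_le_zpow_right₀ one_le_two (by omega)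
    have hi' : (2 : ℝ) ^ (i' + 1) ≤ (2 : ℝ) ^ (j - 2) := zpow_le_zpow_right₀ one_le_two (by omega)
    have hsum : (2 : ℝ) ^ (j - 2) + (2 : ℝ) ^ (j - 2) = (2 : ℝ) ^ (j - 1) := by
      rw [← two_mul, ← zpow_one_add₀ two_ne_zero]; congr 1; ring
    linarith [not_le.1 hξ]

/-- **Paraproduct vanishing, low output**: `Δ̇_j (Δ̇_i a · Δ̇_{i'} b) = 0` for `j ≤ i - 3` and
`i' ≤ i - 3`: the product of a high block with a much lower one keeps frequencies
`≥ 2^{i-1} - 2^{i'+1} ≥ 2^{i-2} ≥ 2^{j+1}`, where `φ_j` vanishes (BCD §2.6). [folklore] -/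
theorem blockS_mulS_blockS_eq_zero_of_le_sub {i i' j : ℤ} (a b : 𝓢(E, ℂ)) (hj : j ≤ i - 3)
    (hi' : i' ≤ i - 3) : blockS j (mulS (blockS i a) (blockS i' b)) = 0 := by
  refine blockS_eq_zero_of_fourier fun ξ => ?_
  by_cases hξ : (2 : ℝ) ^ (j + 1) ≤ ‖ξ‖
  · rw [dyadicSymbol_apply_of_le_norm_holds hξ, zero_mul]
  · rw [fourier_mulS_apply_eq_zero_of_norm_add_lt (ra := (2 : ℝ) ^ (i - 1)) (Rb := (2 : ℝ) ^ (i' + 1))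
        (fun η hη => fourier_blockS_apply_eq_zero_of_norm_le a hη.le)
        (fun η hη => fourier_blockS_apply_eq_zero_of_le_norm b hη.le) ?_, mul_zero]
    have h1 : (2 : ℝ) ^ (j + 1) ≤ (2 : ℝ) ^ (i - 2) := zpow_le_zpow_right₀ one_le_two (by omega)
    have h2 : (2 : ℝ) ^ (i' + 1) ≤ (2 : ℝ) ^ (i - 2) := zpow_le_zpow_right₀ one_le_two (by omega)
    have hsum : (2 : ℝ) ^ (i - 2) + (2 : ℝ) ^ (i - 2) = (2 : ℝ) ^ (i - 1) := by
      rw [← two_mul, ← zpow_one_add₀ two_ne_zero]; congr 1; ring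
    linarith [not_le.1 hξ]

/-- The symmetric low-output case: `Δ̇_j (Δ̇_i a · Δ̇_{i'} b) = 0` for `j ≤ i' - 3` and
`i ≤ i' - 3` (commutativity of the product). [folklore] -/
theorem blockS_mulS_blockS_eq_zero_of_le_sub' {i i' j : ℤ} (a b : 𝓢(E, ℂ)) (hj : j ≤ i' - 3)
    (hi : i ≤ i' - 3) : blockS j (mulS (blockS i a) (blockS i' b)) = 0 := by
  have hcomm : mulS (blockS i a) (blockS i' b) = mulS (blockS i' b) (blockS i a) := by
    ext x; simp [mul_comm]
  rw [hcomm]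
  exact blockS_mulS_blockS_eq_zero_of_le_sub b a hj hi

end SchwartzBlocks

/-! ## Paraproduct vanishing for `L²` functions (density) -/

section L2Blocks

variable {E : Type*} [NormedAddCommGroup E] [InnerProductSpace ℝ E] [FiniteDimensional ℝ E]
  [MeasurableSpace E] [BorelSpace E]

/-- The vanishing index configurations of Bony's decomposition for the output block `j` of a
product of blocks `i`, `i'`: high output (`j ≥ max i i' + 3`) or low output against a separated
pair (`j, i' ≤ i - 3` or `j, i ≤ i' - 3`). [folklore] -/
def ParaproductVanishing (i i' j : ℤ) : Prop :=
  max i i' + 3 ≤ j ∨ (j ≤ i - 3 ∧ i' ≤ i - 3) ∨ (j ≤ i' - 3 ∧ i ≤ i' - 3)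

/-- **Schwartz case**: `Δ̇_j (Δ̇_i a · Δ̇_{i'} b) = 0` as functions, in the vanishing
configurations. [folklore] -/
theorem blockFn_mul_eq_zero_schwartz {i i' j : ℤ} (h : ParaproductVanishing i i' j) (a b : 𝓢(E, ℂ)) :
    blockFn j (fun x => blockFn i (a : E → ℂ) x * blockFn i' (b : E → ℂ) x) = 0 := by
  have hS : blockS j (mulS (blockS i a) (blockS i' b)) = 0 := by
    rcases h with h1 | ⟨h2, h3⟩ | ⟨h4, h5⟩
    · exact blockS_mulS_blockS_eq_zero_of_le a b h1
    · exact blockS_mulS_blockS_eq_zero_of_le_sub a b h2 h3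
    · exact blockS_mulS_blockS_eq_zero_of_le_sub' a b h4 h5
  have hcoe := congrArg (fun φ : 𝓢(E, ℂ) => (φ : E → ℂ)) hS
  simp only [coe_blockS, FunLike.coe_zero] at hcoe
  have hm : ((mulS (blockS i a) (blockS i' b) : 𝓢(E, ℂ)) : E → ℂ) =
      fun x => blockFn i (a : E → ℂ) x * blockFn i' (b : E → ℂ) x := by
    funext x; rw [mulS_apply, coe_blockS, coe_blockS]
  rwa [hm] at hcoe

/-- Hölder for the product of two blocks of `L²` functions: it is integrable, with
`‖Δ̇_i u · Δ̇_{i'} w‖_{L¹} ≤ ‖K_i‖₁ ‖u‖₂ · ‖K_{i'}‖₁ ‖w‖₂`. [folklore] -/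
theorem eLpNorm_blockFn_mul_blockFn_le (i i' : ℤ) {u w : E → ℂ} (hu : MemLp u 2 volume)
    (hw : MemLp w 2 volume) :
    eLpNorm (fun x => blockFn i u x * blockFn i' w x) 1 volume ≤
      ((∫⁻ y, ‖blockKernel E i y‖ₑ) * eLpNorm u 2 volume) *
        ((∫⁻ y, ‖blockKernel E i' y‖ₑ) * eLpNorm w 2 volume) := by
  have h1 : eLpNorm (fun x => blockFn i u x * blockFn i' w x) 1 volume ≤
      eLpNorm (blockFn i u) 2 volume * eLpNorm (blockFn i' w) 2 volume := by
    have := eLpNorm_smul_le_mul_eLpNorm (p := 2) (q := 2) (r := 1)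
      (aestronglyMeasurable_blockFn i' hw.1) (aestronglyMeasurable_blockFn i hu.1) (μ := volume)
    simpa only [Pi.smul_def, smul_eq_mul, Pi.mul_def] using this
  refine h1.trans (mul_le_mul' ?_ ?_)
  · exact eLpNorm_blockFn_le i hu.1 one_le_two
  · exact eLpNorm_blockFn_le i' hw.1 one_le_two

/-- The product of two blocks of `L²` functions is integrable. [folklore] -/
theorem memLp_one_blockFn_mul_blockFn (i i' : ℤ) {u w : E → ℂ} (hu : MemLp u 2 volume)
    (hw : MemLp w 2 volume) : MemLp (fun x => blockFn i u x * blockFn i' w x) 1 volume := by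
  have := (memLp_blockFn i' hw one_le_two).smul (r := 1) (memLp_blockFn i hu one_le_two)
    (p := 2) (q := 2)
  simpa only [Pi.smul_def, smul_eq_mul, Pi.mul_def] using this

/-- **Pointwise bound for the block of a product of blocks**:
`‖Δ̇_j (Δ̇_i u · Δ̇_{i'} w)(x)‖ ≤ ‖K_j‖_∞ ‖K_i‖₁ ‖K_{i'}‖₁ ‖u‖₂ ‖w‖₂`. [folklore] -/
theorem enorm_blockFn_mul_blockFn_le (i i' j : ℤ) {u w : E → ℂ} (hu : MemLp u 2 volume)
    (hw : MemLp w 2 volume) (x : E) :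
    ‖blockFn j (fun x => blockFn i u x * blockFn i' w x) x‖ₑ ≤
      eLpNorm (blockKernel E j) ∞ volume * (((∫⁻ y, ‖blockKernel E i y‖ₑ) * eLpNorm u 2 volume) *
        ((∫⁻ y, ‖blockKernel E i' y‖ₑ) * eLpNorm w 2 volume)) := by
  refine (enorm_blockFn_le j (memLp_one_blockFn_mul_blockFn i i' hu hw).1 1 ∞ x).trans ?_
  gcongr
  exact eLpNorm_blockFn_mul_blockFn_le i i' hu hw

/-- Bilinearity of the block of a product of blocks in the first factor. [folklore] -/
theorem blockFn_mul_sub_left (i i' j : ℤ) {u u' w : E → ℂ} (hu : MemLp u 2 volume)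
    (hu' : MemLp u' 2 volume) (hw : MemLp w 2 volume) :
    blockFn j (fun x => blockFn i u x * blockFn i' w x) - blockFn j (fun x => blockFn i u' x * blockFn i' w x) =
      blockFn j (fun x => blockFn i (u - u') x * blockFn i' w x) := by
  rw [← blockFn_sub j (memLp_one_blockFn_mul_blockFn i i' hu hw) (memLp_one_blockFn_mul_blockFn i i' hu' hw)]
  congr 1
  funext x
  simp only [Pi.sub_apply, blockFn_sub i hu hu', sub_mul]

/-- Bilinearity of the block of a product of blocks in the second factor. [folklore] -/
theorem blockFn_mul_sub_right (i i' j : ℤ) {u w w' : E → ℂ} (hu : MemLp u 2 volume)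
    (hw : MemLp w 2 volume) (hw' : MemLp w' 2 volume) :
    blockFn j (fun x => blockFn i u x * blockFn i' w x) - blockFn j (fun x => blockFn i u x * blockFn i' w' x) =
      blockFn j (fun x => blockFn i u x * blockFn i' (w - w') x) := by
  rw [← blockFn_sub j (memLp_one_blockFn_mul_blockFn i i' hu hw) (memLp_one_blockFn_mul_blockFn i i' hu hw')]
  congr 1
  funext x
  simp only [Pi.sub_apply, blockFn_sub i' hw hw', mul_sub]

/-- **Schwartz approximation in `L²`**: every `f ∈ L²(E; ℂ)` is the `L²` limit of Schwartz
functions (Mathlib `SchwartzMap.denseRange_toLpCLM`). [folklore] -/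
theorem exists_schwartz_tendsto_eLpNorm_sub {f : E → ℂ} (hf : MemLp f 2 volume) :
    ∃ a : ℕ → 𝓢(E, ℂ), Tendsto (fun n => eLpNorm ((a n : E → ℂ) - f) 2 volume) atTop (𝓝 0) := by
  have hdense := SchwartzMap.denseRange_toLpCLM (E := E) (F := ℂ) (p := 2) ENNReal.ofNat_ne_top
    (μ := (volume : Measure E))
  have hmem : hf.toLp f ∈ closure (Set.range (SchwartzMap.toLpCLM ℝ ℂ 2 (volume : Measure E))) := by
    rw [hdense.closure_range]; exact Set.mem_univ _
  obtain ⟨x, hx, hlim⟩ := mem_closure_iff_seq_limit.1 hmem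
  choose a ha using hx
  refine ⟨a, ?_⟩
  have h1 : Tendsto (fun n => SchwartzMap.toLpCLM ℝ ℂ 2 (volume : Measure E) (a n)) atTop (𝓝 (hf.toLp f)) :=
    hlim.congr fun n => (ha n).symm
  rw [Lp.tendsto_Lp_iff_tendsto_eLpNorm'] at h1
  refine h1.congr fun n => eLpNorm_congr_ae ?_
  filter_upwards [hf.coeFn_toLp, (a n).coeFn_toLp 2 (volume : Measure E)] with y hy hy'
  simp only [Pi.sub_apply, hy, SchwartzMap.toLpCLM_apply, hy']

/-- **Paraproduct vanishing in `L²`** (BCD §2.6, Bony's decomposition: the blocks `Δ̇_j` see only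
the near-diagonal products): for `u, w ∈ L²(E; ℂ)` and a vanishing configuration of indices,
`Δ̇_j (Δ̇_i u · Δ̇_{i'} w) = 0` — from the Schwartz case by density, the trilinear expression being
continuous `L² × L² → L^∞`. [folklore] -/
theorem blockFn_mul_eq_zero {i i' j : ℤ} (h : ParaproductVanishing i i' j) {u w : E → ℂ}
    (hu : MemLp u 2 volume) (hw : MemLp w 2 volume) :
    blockFn j (fun x => blockFn i u x * blockFn i' w x) = 0 := by
  obtain ⟨a, ha⟩ := exists_schwartz_tendsto_eLpNorm_sub hu
  obtain ⟨b, hb⟩ := exists_schwartz_tendsto_eLpNorm_sub hw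
  have haL : ∀ n, MemLp (a n : E → ℂ) 2 volume := fun n => (a n).memLp 2 volume
  have hbL : ∀ n, MemLp (b n : E → ℂ) 2 volume := fun n => (b n).memLp 2 volume
  set T : (E → ℂ) → (E → ℂ) → E → ℂ := fun u w => blockFn j (fun x => blockFn i u x * blockFn i' w x)
    with hT
  -- the constant of the trilinear bound
  set M : ℝ≥0∞ := eLpNorm (blockKernel E j) ∞ volume * ((∫⁻ y, ‖blockKernel E i y‖ₑ) *
    (∫⁻ y, ‖blockKernel E i' y‖ₑ)) with hM
  have hMtop : M ≠ ∞ := ENNReal.mul_ne_top (eLpNorm_blockKernel_lt_top j ∞).ne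
    (ENNReal.mul_ne_top (integrable_blockKernel i).2.ne (integrable_blockKernel i').2.ne)
  have hbound : ∀ (u w : E → ℂ), MemLp u 2 volume → MemLp w 2 volume → ∀ x,
      ‖T u w x‖ₑ ≤ M * (eLpNorm u 2 volume * eLpNorm w 2 volume) := by
    intro u w hu hw x
    refine (enorm_blockFn_mul_blockFn_le i i' j hu hw x).trans_eq ?_
    simp only [hM]; ring
  funext x
  simp only [Pi.zero_apply]
  -- `T u w x = (T u w - T aₙ w) + (T aₙ w - T aₙ bₙ) + T aₙ bₙ`, the last term vanishing
  have hsplit : ∀ n, ‖T u w x‖ₑ ≤ M * (eLpNorm (u - (a n : E → ℂ)) 2 volume * eLpNorm w 2 volume) +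
      M * (eLpNorm (a n : E → ℂ) 2 volume * eLpNorm (w - (b n : E → ℂ)) 2 volume) := by
    intro n
    have h0 : T (a n) (b n) = 0 := blockFn_mul_eq_zero_schwartz h (a n) (b n)
    have e1 : T u w x = (T u w - T (a n) w) x + (T (a n) w - T (a n) (b n)) x := by
      simp only [Pi.sub_apply, h0, Pi.zero_apply, sub_zero, sub_add_cancel]
    rw [e1, hT, blockFn_mul_sub_left i i' j hu (haL n) hw, blockFn_mul_sub_right i i' j (haL n) hw (hbL n)]
    exact (enorm_add_le _ _).trans (add_le_add (hbound _ _ (hu.sub (haL n)) hw x)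
      (hbound _ _ (haL n) (hw.sub (hbL n)) x))
  -- the right-hand side tends to `0`
  have hlim : Tendsto (fun n => M * (eLpNorm (u - (a n : E → ℂ)) 2 volume * eLpNorm w 2 volume) +
      M * (eLpNorm (a n : E → ℂ) 2 volume * eLpNorm (w - (b n : E → ℂ)) 2 volume)) atTop (𝓝 0) := by
    have ha' : Tendsto (fun n => eLpNorm (u - (a n : E → ℂ)) 2 volume) atTop (𝓝 0) :=
      ha.congr fun n => by rw [← eLpNorm_neg, neg_sub]
    have hb' : Tendsto (fun n => eLpNorm (w - (b n : E → ℂ)) 2 volume) atTop (𝓝 0) :=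
      hb.congr fun n => by rw [← eLpNorm_neg, neg_sub]
    -- `‖aₙ‖₂ ≤ ‖u‖₂ + ‖aₙ - u‖₂` is bounded
    have hbd : Tendsto (fun n => eLpNorm (a n : E → ℂ) 2 volume * eLpNorm (w - (b n : E → ℂ)) 2 volume) atTop (𝓝 0) := by
      have hle : ∀ n, eLpNorm (a n : E → ℂ) 2 volume * eLpNorm (w - (b n : E → ℂ)) 2 volume ≤
          (eLpNorm u 2 volume + eLpNorm ((a n : E → ℂ) - u) 2 volume) * eLpNorm (w - (b n : E → ℂ)) 2 volume := by
        intro n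
        gcongr
        calc eLpNorm (a n : E → ℂ) 2 volume = eLpNorm (u + ((a n : E → ℂ) - u)) 2 volume := by
              congr 1; funext y; simp
          _ ≤ eLpNorm u 2 volume + eLpNorm ((a n : E → ℂ) - u) 2 volume :=
              eLpNorm_add_le hu.1 ((haL n).sub hu).1 one_le_two
      have hlim2 : Tendsto (fun n => (eLpNorm u 2 volume + eLpNorm ((a n : E → ℂ) - u) 2 volume) *
          eLpNorm (w - (b n : E → ℂ)) 2 volume) atTop (𝓝 ((eLpNorm u 2 volume + 0) * 0)) :=
        ENNReal.Tendsto.mul (tendsto_const_nhds.add ha) (Or.inr ENNReal.zero_ne_top) hb'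
          (Or.inr (by simpa using hu.eLpNorm_ne_top))
      rw [mul_zero] at hlim2
      exact tendsto_of_tendsto_of_tendsto_of_le_of_le tendsto_const_nhds hlim2 (fun _ => bot_le) hle
    have h1 : Tendsto (fun n => M * (eLpNorm (u - (a n : E → ℂ)) 2 volume * eLpNorm w 2 volume)) atTop (𝓝 (M * (0 * eLpNorm w 2 volume))) :=
      ENNReal.Tendsto.const_mul (ENNReal.Tendsto.mul_const ha' (Or.inr hw.eLpNorm_ne_top)) (Or.inr hMtop)
    have h2 : Tendsto (fun n => M * (eLpNorm (a n : E → ℂ) 2 volume * eLpNorm (w - (b n : E → ℂ)) 2 volume)) atTop (𝓝 (M * 0)) :=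
      ENNReal.Tendsto.const_mul hbd (Or.inr hMtop)
    simpa using h1.add h2
  have : ‖T u w x‖ₑ ≤ 0 := ge_of_tendsto' hlim hsplit
  simpa using this

end L2Blocks

/-! ## Real fields: scalar products and scalar–vector products -/

section RealBlocks

variable {E : Type*} [NormedAddCommGroup E] [InnerProductSpace ℝ E] [FiniteDimensional ℝ E]
  [MeasurableSpace E] [BorelSpace E]

/-- Blocks commute with the embedding `ℝ ⊆ ℂ`: `Δ̇_j (f : ℂ) = (Δ̇_j f : ℂ)` for `f ∈ L^p`. [folklore] -/
theorem blockFn_ofReal {p : ℝ≥0∞} [Fact (1 ≤ p)] (j : ℤ) {f : E → ℝ} (hf : MemLp f p volume) :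
    blockFn j (fun x => (f x : ℂ)) = fun x => ((blockFn j f x : ℝ) : ℂ) :=
  blockFn_comp_clm j Complex.ofRealCLM hf

/-- A real `L^p` function has a complexification in `L^p`. [folklore] -/
theorem memLp_ofReal {p : ℝ≥0∞} {f : E → ℝ} (hf : MemLp f p volume) :
    MemLp (fun x => (f x : ℂ)) p volume :=
  MemLp.of_le (hf.norm.const_mul 1 |>.congr_norm (Complex.ofRealCLM.continuous.comp_aestronglyMeasurable hf.1)
    (Eventually.of_forall fun x => by simp)) (Complex.ofRealCLM.continuous.comp_aestronglyMeasurable hf.1)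
    (Eventually.of_forall fun x => by simp)

/-- **Paraproduct vanishing for real scalar functions**: for `f, g ∈ L²(E; ℝ)` and a vanishing
configuration, `Δ̇_j (Δ̇_i f · Δ̇_{i'} g) = 0`. [folklore] -/
theorem blockFn_mul_eq_zero_real {i i' j : ℤ} (h : ParaproductVanishing i i' j) {f g : E → ℝ}
    (hf : MemLp f 2 volume) (hg : MemLp g 2 volume) :
    blockFn j (fun x => blockFn i f x * blockFn i' g x) = 0 := by
  have hC := blockFn_mul_eq_zero h (memLp_ofReal hf) (memLp_ofReal hg)
  rw [blockFn_ofReal i hf, blockFn_ofReal i' hg] at hC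
  have hprod : (fun x => ((blockFn i f x : ℝ) : ℂ) * ((blockFn i' g x : ℝ) : ℂ)) =
      fun x => (((blockFn i f x * blockFn i' g x : ℝ)) : ℂ) := by
    funext x; push_cast; ring
  rw [hprod] at hC
  -- the real product is integrable, so its block commutes with `ℝ ⊆ ℂ`
  haveI : Fact (1 ≤ (1 : ℝ≥0∞)) := ⟨le_rfl⟩
  have hint : MemLp (fun x => blockFn i f x * blockFn i' g x) 1 volume := by
    have := (memLp_blockFn i' hg one_le_two).smul (r := 1) (memLp_blockFn i hf one_le_two) (p := 2) (q := 2)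
    simpa only [Pi.smul_def, smul_eq_mul, Pi.mul_def] using this
  rw [blockFn_ofReal j hint] at hC
  funext x
  have := congrFun hC x
  simpa using this

variable {ι : Type*} [Fintype ι]

/-- The coordinates of an `L^p` vector field are `L^p`. [folklore] -/
theorem memLp_euclidean_proj {p : ℝ≥0∞} {w : E → EuclideanSpace ℝ ι} (hw : MemLp w p volume) (l : ι) :
    MemLp (fun x => w x l) p volume := by
  have := (EuclideanSpace.proj (𝕜 := ℝ) l).comp_memLp' hw
  exact this

/-- **Paraproduct vanishing for a real scalar times a real vector field**: for `f ∈ L²(E; ℝ)`,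
`w ∈ L²(E; ℝ^ι)` and a vanishing configuration, `Δ̇_j (Δ̇_i f • Δ̇_{i'} w) = 0` (coordinatewise
reduction to the scalar case; this is the shape `Δ̇_j (u_i^k u_{i'})` of the terms of
`Δ̇_j (u ⊗ u)` in Cheskidov–Shvydkoy's decomposition of `(u ⊗ u)_q`). [folklore] -/
theorem blockFn_smul_eq_zero_real {i i' j : ℤ} (h : ParaproductVanishing i i' j) {f : E → ℝ}
    {w : E → EuclideanSpace ℝ ι} (hf : MemLp f 2 volume) (hw : MemLp w 2 volume) :
    blockFn j (fun x => blockFn i f x • blockFn i' w x) = 0 := by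
  -- the product is integrable
  haveI : Fact (1 ≤ (1 : ℝ≥0∞)) := ⟨le_rfl⟩
  have hint : MemLp (fun x => blockFn i f x • blockFn i' w x) 1 volume :=
    (memLp_blockFn i' hw one_le_two).smul (r := 1) (memLp_blockFn i hf one_le_two) (p := 2) (q := 2)
  funext x
  -- test against each coordinate
  refine PiLp.ext fun l => ?_
  have hl : (blockFn j (fun x => blockFn i f x • blockFn i' w x) x) l =
      blockFn j (fun y => blockFn i f y * blockFn i' (fun z => w z l) y) x := by
    have h1 := congrFun (blockFn_comp_clm j (EuclideanSpace.proj (𝕜 := ℝ) l) hint) x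
    have h2 := congrFun (blockFn_comp_clm i' (EuclideanSpace.proj (𝕜 := ℝ) l) hw)
    change (EuclideanSpace.proj (𝕜 := ℝ) l) (blockFn j (fun x => blockFn i f x • blockFn i' w x) x) = _
    rw [← h1]
    congr 1
    funext y
    change (EuclideanSpace.proj (𝕜 := ℝ) l) (blockFn i f y • blockFn i' w y) = _
    rw [map_smul, smul_eq_mul, ← h2 y]
    rfl
  rw [hl, blockFn_mul_eq_zero_real h hf (memLp_euclidean_proj hw l)]
  simp

end RealBlocks

end Literature.Analysis.FunctionSpaces

end
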